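import Literature.NumberTheory.GaloisCohomology.Howard2004.TowerMorphism
import Literature.NumberTheory.GaloisCohomology.Howard2004.CohomologyMapBijectiveTransportProofs
import Literature.NumberTheory.GaloisCohomology.Howard2004.KolyvaginSystemScalars
import HarnessLib

/-!
# Howard 2004, §1.6: at a level killed by `I_n` the presentation `T^{(k)} ↠ T^{(k)}/I_nT^{(k)}` is an
# isomorphism, and `H¹_{F(n)}(K, T^{(k)}/I_n)` (`LevelData.selmerAt`) IS `H¹_{F(n)}(K, T^{(k)})`

Topic `NumberTheory/GaloisCohomology/Howard2004` (instantiation layer of Howard's Lemma 1.6.4 — the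
residual Galois input of the print leaf G87 `Howard2004.thm161_dvrKolyvaginBound` = Thm. 1.6.1; cell
`pub/bsd-print-x9`, seat `bsd-line-x10b-p1-w2` g15).  THEOREMS ONLY: no definition, no named fact, no
instance, no notation, no `sorry`.  Bridge between the two currencies of the cell: the Kolyvagin classes
live in `H¹_{F(n)}(K, T^{(k)}/I_nT^{(k)}) ⊗ G_n` on the PRESENTATIONS of `LevelData` (`selmerAt`), while
the tower theorems (Lemma 1.3.3 at level `n`, `TransverseCartesianProofs`; the structure, the stubs)
live on `H¹(K, T^{(k)})` with the modified structure `F(n) = (t.atLevel jbar n).cond`.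

Printed source.  B. Howard, *The Heegner point Kolyvagin system*, Compositio Math. **140** (2004)
= arXiv:1202.6340, §1.6 (arXiv p. 11 L33–38): «`R^{(k)} = R/𝔪^k`, `T^{(k)} = T/𝔪^kT`,
`𝓛^{(k)} = 𝓛 ∩ 𝓛_k(T)` … for `ℓ ∈ 𝓝^{(k)}` we have a decomposition `H¹_{F(n)}(K, T^{(k)}) ≅ …`» — for
`n ∈ 𝓝^{(k)}` the ideal `I_n ⊆ 𝔪^k` kills `T^{(k)}`, so `T^{(k)}/I_nT^{(k)} = T^{(k)}` and Howard writes
`H¹_{F(n)}(K, T^{(k)})` for what Def. 1.2.3 calls `H¹_{F(n)}(K, T/I_nT)` at the level `k`; Def. 1.1.3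
(arXiv p. 5 L93–99): the objects of `Quot(T)` are determined up to their canonical isomorphism.

* §1 (any presentation `h : IsQuotientBy ρ I ρI π`) `IsQuotientBy.localization_cohomologyMap` (at EVERY
  place, localisation commutes with `H¹(π)`), `bijective_cohomologyMap_of_ker_eq_bot`,
  `bijective_localCohomologyMap_of_ker_eq_bot` (`ker π = 0` ⇒ `H¹(π)` bijective, globally and locally),
  **`cohomologyMap_mem_selmerGroup_propagateStructure_iff`** (`H¹(π) x` is Selmer for the propagated
  structure iff `x` is Selmer) and `exists_mem_selmerGroup_cohomologyMap_eq`.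
* §2 (`LevelData`) **`LevelData.cohomologyMap_mem_selmerAt_iff`**: for `ker π_n = 0`,
  `H¹(π_n) x ∈ H¹_{F(n)}(K, T/I_nT) ↔ x ∈ H¹_{F(n)}(K, T)`; **`exists_unique_mem_selmerGroup_atLevel_eq`**:
  every class of `selmerAt n` is `H¹(π_n) x` for a unique `F(n)`-Selmer class `x`.

HONEST FRAMING.  Functoriality bookkeeping; `ker π_n = 0` (= `I_n` kills the level) is the hypothesis;
Lemma 1.6.4 / Thm. 1.6.1 / `thm161_dvrKolyvaginBound` are NOT proved; no summit statement is proved;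
the Birch–Swinnerton-Dyer conjecture is not proved by any of this.

References: [Howard2004HeegnerKolyvagin] Def. 1.1.3, Def. 1.2.3, §1.6 (arXiv p. 5 L93–99, p. 7 L1–12,
p. 11 L33–38); [SerreGaloisCohomology1997] I §2.2, II §6.1.
-/

set_option autoImplicit false

noncomputable section

open Function NumberField IsDedekindDomain Field
open scoped NumberField ContRepresentation

namespace Literature.NumberTheory.GaloisCohomology.Howard2004

open CategoryTheory
open Literature.NumberTheory.GaloisRepresentations
open Literature.NumberTheory.GaloisRepresentations.DiscreteGaloisModule

/-! ## §1 A presentation with `ker π = 0`: `H¹(π)` is bijective and respects the Selmer groups -/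

namespace IsQuotientBy

variable {K : Type} [Field K] [NumberField K] {M : Type} [AddCommGroup M] [TopologicalSpace M]
  [DiscreteTopology M] {R : Type} [CommRing R] [Module R M]
  {N : Type} [AddCommGroup N] [TopologicalSpace N] [DiscreteTopology N] [Module R N]
  {ρ : DiscreteGaloisModule K M} {I : Ideal R} {ρI : DiscreteGaloisModule K N} {π : M →ₗ[R] N}

/-- **Localisation commutes with `H¹(π)` at every place**: `loc_v (H¹(π) x) = H¹(K_v, π)(loc_v x)`.
[cite: SerreGaloisCohomology1997, Ch. I §2.4 and Ch. II §6.1] -/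
theorem localization_cohomologyMap (h : IsQuotientBy ρ I ρI π) (v : Place K)
    (x : galoisCohomology ρ 1) :
    galoisCohomology.localization ρI v 1 (h.cohomologyMap 1 x) =
      h.localCohomologyMap v 1 (galoisCohomology.localization ρ v 1 x) :=
  Literature.NumberTheory.EllipticCurves.DiscreteGaloisModule.localization_map_one
    ⟨⟨π.toAddMonoidHom.toIntLinearMap, continuous_of_discreteTopology⟩,
      fun σ => ContinuousLinearMap.ext fun y => h.equivariant σ y⟩ v x

omit [NumberField K] in
/-- A presentation with `ker π = 0` is a bijection `T ≅ T/IT` («`IT = 0`»).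
[cite: Howard2004HeegnerKolyvagin, Def. 1.1.3 (arXiv p. 5 L93–99)] -/
theorem bijective_of_ker_eq_bot (h : IsQuotientBy ρ I ρI π) (hker : LinearMap.ker π = ⊥) :
    Function.Bijective π.toAddMonoidHom :=
  ⟨LinearMap.ker_eq_bot.1 hker, h.surjective⟩

omit [NumberField K] in
/-- **`H¹(K, π)` is bijective when `ker π = 0`.** [cite: Howard2004HeegnerKolyvagin, Def. 1.1.3 (arXiv p. 5 L93–99)] [cite: SerreGaloisCohomology1997, Ch. I §2.2] -/
theorem bijective_cohomologyMap_of_ker_eq_bot (h : IsQuotientBy ρ I ρI π) (hker : LinearMap.ker π = ⊥) :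
    Function.Bijective (h.cohomologyMap 1) :=
  bijective_cohomologyMap_of_bijective ρ ρI π.toAddMonoidHom h.equivariant (h.bijective_of_ker_eq_bot hker)

/-- **`H¹(K_v, π)` is bijective when `ker π = 0`**, at every place. [cite: Howard2004HeegnerKolyvagin, Def. 1.1.3 (arXiv p. 5 L93–99)] [cite: SerreGaloisCohomology1997, Ch. I §2.2] -/
theorem bijective_localCohomologyMap_of_ker_eq_bot (h : IsQuotientBy ρ I ρI π)
    (hker : LinearMap.ker π = ⊥) (v : Place K) :
    Function.Bijective (h.localCohomologyMap v 1) :=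
  bijective_cohomologyMap_of_bijective (ρ.toLocal v) (ρI.toLocal v) π.toAddMonoidHom
    (fun _ m => h.equivariant _ m) (h.bijective_of_ker_eq_bot hker)

/-- **`H¹(π) x` is Selmer for the propagated structure iff `x` is Selmer** (`ker π = 0`): place by
place `loc_v (H¹(π) x) = H¹(K_v, π)(loc_v x)` and `H¹(K_v, π)` is injective.
[cite: Howard2004HeegnerKolyvagin, Def. 1.1.3 and Def. 1.1.10 (arXiv pp. 5–6)] -/
theorem cohomologyMap_mem_selmerGroup_propagateStructure_iff (h : IsQuotientBy ρ I ρI π)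
    (hker : LinearMap.ker π = ⊥) (𝓕 : SelmerStructure ρ) (x : galoisCohomology ρ 1) :
    h.cohomologyMap 1 x ∈ (h.propagateStructure 𝓕).selmerGroup ↔ x ∈ 𝓕.selmerGroup := by
  simp only [SelmerStructure.mem_selmerGroup_iff, propagateStructure_apply, h.localization_cohomologyMap]
  refine forall_congr' fun v => ?_
  constructor
  · rintro ⟨y, hy, hyx⟩
    rwa [← (h.bijective_localCohomologyMap_of_ker_eq_bot hker v).1 hyx]
  · intro hx
    exact ⟨_, hx, rfl⟩

/-- Every Selmer class of the propagated structure on `T/IT` is `H¹(π) x` for a Selmer class `x` of `T`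
(`ker π = 0`). [cite: Howard2004HeegnerKolyvagin, Def. 1.1.3 and Def. 1.1.10 (arXiv pp. 5–6)] -/
theorem exists_mem_selmerGroup_cohomologyMap_eq (h : IsQuotientBy ρ I ρI π)
    (hker : LinearMap.ker π = ⊥) (𝓕 : SelmerStructure ρ) {c : galoisCohomology ρI 1}
    (hc : c ∈ (h.propagateStructure 𝓕).selmerGroup) :
    ∃ x ∈ 𝓕.selmerGroup, h.cohomologyMap 1 x = c := by
  obtain ⟨x, rfl⟩ := (h.bijective_cohomologyMap_of_ker_eq_bot hker).2 c
  exact ⟨x, (h.cohomologyMap_mem_selmerGroup_propagateStructure_iff hker 𝓕 x).1 hc, rfl⟩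

end IsQuotientBy

/-! ## §2 `H¹_{F(n)}(K, T/I_nT) = H¹(π_n)(H¹_{F(n)}(K, T))` for a level killed by `I_n` -/

namespace LevelData

variable {K : Type} [Field K] [NumberField K] {M : Type} [AddCommGroup M] [TopologicalSpace M]
  [DiscreteTopology M] {R : Type} [CommRing R] [Module R M]
  {p : ℕ} [Fact p.Prime] {ρ : DiscreteGaloisModule K M} {t : SelmerTriple p ρ}
  {N : Finset (HeightOneSpectrum (𝓞 K)) → Type} [∀ n, AddCommGroup (N n)]
  [∀ n, TopologicalSpace (N n)] [∀ n, DiscreteTopology (N n)] [∀ n, Module R (N n)]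

/-- **`H¹(π_n) x ∈ H¹_{F(n)}(K, T/I_nT) ↔ x ∈ H¹_{F(n)}(K, T)`** when `I_n` kills `T` (`ker π_n = 0`;
Howard's `n ∈ 𝓝^{(k)}` for `T = T^{(k)}`). [cite: Howard2004HeegnerKolyvagin, Def. 1.2.3 and §1.6 (arXiv p. 7 L1–12, p. 11 L33–38)] -/
theorem cohomologyMap_mem_selmerAt_iff (D : LevelData R ρ t N) (jbar : AlgebraicClosure K →+* ℂ)
    (n : Finset (HeightOneSpectrum (𝓞 K))) (hker : LinearMap.ker (D.π n) = ⊥)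
    (x : galoisCohomology ρ 1) :
    (D.isQuotientBy n).cohomologyMap 1 x ∈ D.selmerAt jbar n ↔
      x ∈ ((t.atLevel jbar n).cond).selmerGroup :=
  (D.isQuotientBy n).cohomologyMap_mem_selmerGroup_propagateStructure_iff hker _ x

/-- **Every class of `H¹_{F(n)}(K, T/I_nT)` is `H¹(π_n) x` for a UNIQUE `F(n)`-Selmer class `x` of `T`**
(`ker π_n = 0`): the de-tensored Kolyvagin classes `s_n` of `GnTensorIdentificationProofs` /
`KolyvaginRelationLocalizationProofs` are read on `H¹(K, T^{(k)})`, where `TransverseCartesianProofs`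
(Lemma 1.3.3 at level `n`) applies. [cite: Howard2004HeegnerKolyvagin, Def. 1.2.3 and §1.6 (arXiv p. 7 L1–12, p. 11 L33–38, p. 11 L85–88)] -/
theorem exists_unique_mem_selmerGroup_atLevel_eq (D : LevelData R ρ t N)
    (jbar : AlgebraicClosure K →+* ℂ) (n : Finset (HeightOneSpectrum (𝓞 K)))
    (hker : LinearMap.ker (D.π n) = ⊥) (s : ↥(D.selmerAt jbar n)) :
    ∃! x : galoisCohomology ρ 1,
      x ∈ ((t.atLevel jbar n).cond).selmerGroup ∧ (D.isQuotientBy n).cohomologyMap 1 x = s := by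
  obtain ⟨x, hx, hxs⟩ :=
    (D.isQuotientBy n).exists_mem_selmerGroup_cohomologyMap_eq hker ((t.atLevel jbar n).cond) s.2
  refine ⟨x, ⟨hx, hxs⟩, fun y hy => ?_⟩
  exact ((D.isQuotientBy n).bijective_cohomologyMap_of_ker_eq_bot hker).1 (hy.2.trans hxs.symm)

omit [Fact p.Prime] in
/-- Localisation of a class of `T/I_nT` read on `T`: `loc_v (H¹(π_n) x) = H¹(K_v, π_n)(loc_v x)` — so
«`loc_λ s_n = 0`» for `s_n = H¹(π_n) x` reads «`loc_λ x = 0`» (`H¹(K_λ, π_n)` injective).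
[cite: Howard2004HeegnerKolyvagin, Def. 1.2.3 (arXiv p. 7 L1–12)] -/
theorem localization_cohomologyMap_eq_zero_iff (D : LevelData R ρ t N)
    (n : Finset (HeightOneSpectrum (𝓞 K))) (hker : LinearMap.ker (D.π n) = ⊥) (v : Place K)
    (x : galoisCohomology ρ 1) :
    galoisCohomology.localization (D.ρq n) v 1 ((D.isQuotientBy n).cohomologyMap 1 x) = 0 ↔
      galoisCohomology.localization ρ v 1 x = 0 := by
  rw [(D.isQuotientBy n).localization_cohomologyMap v x]
  constructor
  · intro h0
    apply ((D.isQuotientBy n).bijective_localCohomologyMap_of_ker_eq_bot hker v).1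
    rw [h0, map_zero]
  · intro h0
    rw [h0, map_zero]

end LevelData

end Literature.NumberTheory.GaloisCohomology.Howard2004

end
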